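import Mathlib
import HarnessLib
import Summits.ResolutionOfSingularities.ResolutionOfSingularities.Theorems.WildQuotientsWildQuotientResolutionS1aA1Cover
import Summits.ResolutionOfSingularities.ResolutionOfSingularities.Theorems.WildQuotientsWildQuotientResolutionS1aMoveResidual
import Summits.ResolutionOfSingularities.ResolutionOfSingularities.Theorems.WildQuotientsWildQuotientResolutionS1aAuxCover

/-!
# S1a — INSTANCE I-2 (a1): MOVE 1 of MT-a1″ on a model — a legal admissible move from the root, and on EVERY realisation an explicit atlas whose formal locus lies in the norm chart's residual `V(z₀, z₁)`

[OURS · L1 W4.5c · lead-1 g12; plan-1 RULING R-F15c «I-2 := MT-a1″ (binding): move 1 root (x₁:2, x₂:1; δ1), chart [x₁]₂ KILLED, N(x₂) residual V(x₁′, x₃)»,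
R-F15b (1)/(3)/(6), A-KF v1 §3 (X-scheme)] — NOT statements of the manuscript; counted 0; AI-level work, weaker than expert review. Crux
stmt-ResolutionOfSingularities-17941 `CyclicQuotientFourfolds`, line `s1a-logminvertex` v13 (`stub_reachLowerInFX`).

THE DATUM (as for `J₄`, ✓p645001/✓p660379): action data `(X′, X₁, q, ρ, g₀)` with `X′` AFFINE regular separated, `X₁` separated, `q` finite `G`-invariant,
`G = ⟨g₀⟩` finite, `g₀^p = 1`, `p` prime, `k` of characteristic `p`, `e : Γ(X′, ⊤) ≃ k[x₀..x₃]` intertwining `g₀` with the a1 automorphism `σ`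
(`x₁ ↦ x₁ + x₀`, `x₂ ↦ x₂ + x₀`, `x₃ ↦ x₃ + x₁x₂`).
* ★ `a1_rootChartData` — on the initial model the chart `X′` with the (2,1)-centre `(e⁻¹x₀, e⁻¹x₁)` yields (by ✓`exists_isAdmissibleCentre_of_chartData`) a
  Veronese degree `d`, an ADMISSIBLE `G`-stable centre `𝒦` with `X′` a centre chart, its traces, and the explicit trivial node `(𝒜, e′, actOEquiv g₀)`;
* ★★★ `a1_move1_atlas` — for EVERY realisation `M₁` of that move: the two NORM CHARTS `W_j = M₁[X′, e′⁻¹ y_j]` (`y₀ = x₀^{dp}`, `y₁ = N^{2d}`) are stable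
  affine opens with EXPOSED, PINNED producer nodes `(ChartRing, chartNodeGrading, sigmaChart, E_j)`, and there is an atlas `𝔄₁` on `M₁` (✓`exists_moveAtlas_of_nodeData`)
  with `F_𝔄₁ ⊆ W₁ ∩ V(E₁⁻¹ z₀, E₁⁻¹ z₁)` — `z₀ = X₁^{dp}/(y₁T^{2dp})`, `z₁ = (X₂x₂)^{2dp}/(y₁T^{2dp})` the residual sections (✓`a1_residualSection_*`,
  ✓`principalNear_producerChart_of_mem_residual`, ✓`a1_augmentationIdeal_sigmaR_le`): the `[x₀]₂` chart is KILLED (`z₀ = 1` there) and on the `N(x₁)` chart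
  the formal locus lies in the strict transform `P̃′`. The root decoration `𝔄₀` is ARBITRARY (its formal locus is discarded: `O = X′`).
-/

set_option linter.dupNamespace false

noncomputable section

open CategoryTheory Limits AlgebraicGeometry TopologicalSpace Topology Opposite MvPolynomial
open Literature.AlgebraicGeometry.Resolution Literature.AlgebraicGeometry.RelativeSpec
open scoped LaurentPolynomial
open Summit.ResolutionOfSingularities.ResolutionOfSingularities.Theorems.WildQuotientResolution.S1
open Summit.ResolutionOfSingularities.ResolutionOfSingularities.Theorems.WildQuotientResolution.S1.NodeAtlas
open Summit.ResolutionOfSingularities.ResolutionOfSingularities.Theorems.WildQuotientResolution.S1.CoarseChart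
open Summit.ResolutionOfSingularities.ResolutionOfSingularities.Theorems.WildQuotientResolution.S1.ProducerStep
open Summit.ResolutionOfSingularities.ResolutionOfSingularities.Theorems.WildQuotientResolution.S1.NpFrame
open Summit.ResolutionOfSingularities.ResolutionOfSingularities.Theorems.WildQuotientResolution.S1.GoodCharts
open Summit.ResolutionOfSingularities.ResolutionOfSingularities.Theorems.WildQuotientResolution.S1.BlowupCharts
open Summit.ResolutionOfSingularities.ResolutionOfSingularities.Theorems.WildQuotientResolution.S1.KillableTransport
open Summit.ResolutionOfSingularities.ResolutionOfSingularities.Theorems.WildQuotientResolution.S1.KillCert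
open Summit.ResolutionOfSingularities.ResolutionOfSingularities.Theorems.WildQuotientResolution.BlowupExit

namespace Summit.ResolutionOfSingularities.ResolutionOfSingularities.Theorems.WildQuotientResolution.S1.GameFrame.GModel

variable {p : ℕ} {X' X₁ : Scheme.{0}} {q : X' ⟶ X₁} {G : Type} [Group G] {ρ : G →* Aut X'} {g₀ : G}

/-- The chart `X′` of the initial model, as a stable affine open. -/
theorem exists_topChart_initial (hq : ∀ g : G, (ρ g).hom ≫ q = q) [IsIntegral X'] [IsLocallyNoetherian X'] [IsAffine X'] [IsAffineHom q]
    (h₀ : NodeAtlas p (⟨ρ, hq⟩ : ActionOver q G) g₀) :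
    ∃ O : (GModel.initial (p := p) (g₀ := g₀) hq h₀).act.StableAffineOpens, O.1 = ⊤ := by
  haveI : IsAffine (⊤ : X'.Opens) := isAffineOpen_top X'
  have hAff : IsAffineHom ((⊤ : X'.Opens).ι ≫ q) := inferInstance
  have hst : ∀ g : G, (ρ g).hom ⁻¹ᵁ (⊤ : X'.Opens) = ⊤ := fun g => Scheme.Hom.preimage_top _
  exact ⟨⟨⊤, hst, hAff⟩, rfl⟩

/-- ★ **MOVE 1 OF MT-a1″ IS A LEGAL MOVE, with the explicit root node.** On the initial model of the a1 datum, a stable affine chart `O` (meant: `O = X′`)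
whose ring of sections is `≃ k[x₀..x₃]` by `e`, with `g₀` acting through `e` as the a1 automorphism `σ` and `V(e⁻¹x₀, e⁻¹x₁) ∩ O` closed: the (2,1)-centre
`(e⁻¹x₀, e⁻¹x₁)` (node: sections ring, trivial grading, `σ = actOEquiv g₀`, tautological `e′`) yields a Veronese degree `d` and an ADMISSIBLE `G`-stable
centre `𝒦` with `O` a centre chart and `(𝒦|O)_n = e′⁻¹(trace 𝒥ₙ)`. [OURS · L1 W4.5c · R-F15c move 1] -/
theorem a1_rootChartData [Finite G] (hp : p.Prime) (hG : ∀ g : G, g ∈ Subgroup.zpowers g₀) (hg₀ : g₀ ^ p = 1)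
    (hq : ∀ g : G, (ρ g).hom ≫ q = q) [IsIntegral X'] [IsLocallyNoetherian X'] [X'.IsSeparated]
    (hreg : Scheme.IsRegular X') {k : Type} [Field k] (σ : MvPolynomial (Fin 4) k ≃+* MvPolynomial (Fin 4) k) (hC : ∀ a : k, σ (C a) = C a)
    (h0 : σ (X 0) = X 0) (h1 : σ (X 1) = X 1 + X 0) (h2 : σ (X 2) = X 2 + X 0) (h3 : σ (X 3) = X 3 + X 1 * X 2)
    (h₀ : NodeAtlas p (⟨ρ, hq⟩ : ActionOver q G) g₀) (O : (GModel.initial (p := p) (g₀ := g₀) hq h₀).act.StableAffineOpens) (hO : IsAffineOpen O.1)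
    (e : Γ(X', O.1) ≃+* MvPolynomial (Fin 4) k) (hact : ∀ t : Γ(X', O.1), actOEquiv (GModel.initial hq h₀).act O g₀ t = e.symm (σ (e t)))
    (hZcl : IsClosed (X'.zeroLocus (U := O.1) (Set.range (e.symm ∘ ![X 0, X 1] : Fin 2 → Γ(X', O.1))) ∩ (O.1 : Set (GModel.initial (p := p) (g₀ := g₀) hq h₀).V))) :
    ∃ (𝒜 : (Π j : Fin 0, ZMod ((![] : Fin 0 → ℕ) j)) → AddSubgroup Γ(X', O.1)) (_ : GradedRing 𝒜) (e' : Γ(X', O.1) ≃+* ↥(𝒜 0))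
      (𝒦 : ReesFiltration X') (d : ℕ),
      (∀ i, 𝒜 i = ⊤) ∧ (∀ b, ((e' b : ↥(𝒜 0)) : Γ(X', O.1)) = b) ∧
      IsTameNode p Γ(X', O.1) 𝒜 (actOEquiv (GModel.initial hq h₀).act O g₀) ∧ (∀ x, (⇑(actOEquiv (GModel.initial hq h₀).act O g₀))^[p] x = x) ∧
      (∀ t : Γ(X', O.1), ((e' (((GModel.initial hq h₀).act.aut g₀⁻¹).hom.appLE O.1 O.1 (O.2.1 g₀⁻¹).ge t) : ↥(𝒜 0)) : Γ(X', O.1)) =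
        actOEquiv (GModel.initial hq h₀).act O g₀ ((e' t : ↥(𝒜 0)) : Γ(X', O.1))) ∧
      VeroneseNormalised 𝒜 (e.symm ∘ ![X 0, X 1]) ![2, 1] d ∧
      IsAdmissibleCentre p (GModel.initial hq h₀).act g₀ 𝒦 d ∧ IsCentreChart p (GModel.initial hq h₀).act g₀ 𝒦 d O ∧
      (∀ (g : G) (n : ℕ), (𝒦.ideal n).comap ((GModel.initial hq h₀).act.aut g).hom = 𝒦.ideal n) ∧
      (∀ n, (𝒦.filtration ⟨O.1, hO⟩).ideal n = ((traceFiltration 𝒜 (e.symm ∘ ![X 0, X 1]) ![2, 1]).ideal n).comap (e' : Γ(X', O.1) →+* ↥(𝒜 0))) ∧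
      (((𝒦.ideal d).support : Set X')) = X'.zeroLocus (U := O.1) (Set.range (e.symm ∘ ![X 0, X 1] : Fin 2 → Γ(X', O.1))) ∩ (O.1 : Set (GModel.initial (p := p) (g₀ := g₀) hq h₀).V) := by
  haveI hsep : (GModel.initial (p := p) (g₀ := g₀) hq h₀).V.IsSeparated := ‹X'.IsSeparated›
  have hp1 := hp.pos
  obtain ⟨𝒜, gr, e', 𝒦, d, h𝒜, he', htame, hσp, hσ, -, hver, hadm, hcentre, hG𝒦, -, h𝒦tr, hsupp⟩ :=
    exists_isAdmissibleCentre_of_chartData (p := p) hG hg₀ (GModel.initial hq h₀) hreg O hO (e.symm ∘ ![X 0, X 1]) ![2, 1] (by norm_num)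
      (fun i => by fin_cases i <;> norm_num) (A1.a1_isRegular e) (A1.a1_isRegularRing_quotient e)
      (A1.a1_map_le σ hC h0 h1 h2 h3 e (actOEquiv (GModel.initial hq h₀).act O g₀) hact) hZcl
  exact ⟨𝒜, gr, e', 𝒦, d, h𝒜, he', htame, hσp, hσ, hver, hadm, hcentre, hG𝒦, h𝒦tr, hsupp⟩


/-! ## Move 1 on a realisation: the norm charts, their pinned nodes, and the explicit atlas -/

section Atlas

variable [Finite G] (hp : p.Prime) (hG : ∀ g : G, g ∈ Subgroup.zpowers g₀)
  (hq : ∀ g : G, (ρ g).hom ≫ q = q) [IsIntegral X'] [IsLocallyNoetherian X']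
  {k : Type} [Field k] [CharP k p] (σ : MvPolynomial (Fin 4) k ≃+* MvPolynomial (Fin 4) k) (hC : ∀ a : k, σ (C a) = C a)
  (h0 : σ (X 0) = X 0) (h1 : σ (X 1) = X 1 + X 0) (h2 : σ (X 2) = X 2 + X 0) (h3 : σ (X 3) = X 3 + X 1 * X 2)
  (h₀ : NodeAtlas p (⟨ρ, hq⟩ : ActionOver q G) g₀) (O : (GModel.initial (p := p) (g₀ := g₀) hq h₀).act.StableAffineOpens) (hO : IsAffineOpen O.1)
  (e : Γ(X', O.1) ≃+* MvPolynomial (Fin 4) k) (hact : ∀ t : Γ(X', O.1), actOEquiv (GModel.initial hq h₀).act O g₀ t = e.symm (σ (e t)))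
  (𝒜 : (Π j : Fin 0, ZMod ((![] : Fin 0 → ℕ) j)) → AddSubgroup Γ(X', O.1)) [GradedRing 𝒜] (e' : Γ(X', O.1) ≃+* ↥(𝒜 0))
  (h𝒜 : ∀ i, 𝒜 i = ⊤) (he' : ∀ b, ((e' b : ↥(𝒜 0)) : Γ(X', O.1)) = b)
  (htame : IsTameNode p Γ(X', O.1) 𝒜 (actOEquiv (GModel.initial hq h₀).act O g₀)) (hσp : ∀ x, (⇑(actOEquiv (GModel.initial hq h₀).act O g₀))^[p] x = x)
  (hσ : ∀ t : Γ(X', O.1), ((e' (((GModel.initial hq h₀).act.aut g₀⁻¹).hom.appLE O.1 O.1 (O.2.1 g₀⁻¹).ge t) : ↥(𝒜 0)) : Γ(X', O.1)) =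
    actOEquiv (GModel.initial hq h₀).act O g₀ ((e' t : ↥(𝒜 0)) : Γ(X', O.1)))
  {d : ℕ} (hver : VeroneseNormalised 𝒜 (e.symm ∘ ![X 0, X 1]) ![2, 1] d) (𝒦 : ReesFiltration X')
  (hG𝒦 : ∀ (g : G) (n : ℕ), (𝒦.ideal n).comap ((GModel.initial hq h₀).act.aut g).hom = 𝒦.ideal n)
  (h𝒦tr : ∀ n, (𝒦.filtration ⟨O.1, hO⟩).ideal n = ((traceFiltration 𝒜 (e.symm ∘ ![X 0, X 1]) ![2, 1]).ideal n).comap (e' : Γ(X', O.1) →+* ↥(𝒜 0)))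
  (hsuppO : (((𝒦.ideal d).support : Set X')) ⊆ (O.1 : Set (GModel.initial (p := p) (g₀ := g₀) hq h₀).V))

omit [Finite G] [CharP k p] [GradedRing 𝒜] in
include h𝒜 in
/-- The centre generators lie in the (trivial) degree-0 piece. -/
theorem a1_hf (i : Fin 2) : (e.symm ∘ ![X 0, X 1] : Fin 2 → Γ(X', O.1)) i ∈ 𝒜 ((fun _ => (0 : Π j : Fin 0, ZMod ((![] : Fin 0 → ℕ) j))) i) := by
  rw [h𝒜]; trivial

omit [Finite G] [CharP k p] in
include he' in
/-- The NORM cover element `y₁ = e′(N^{2d})` lies in the trace `K_{2dp}`. -/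
theorem a1_hy_one : haveI : NeZero p := ⟨hp.ne_zero⟩;
    e' ((∏ i : ZMod p, (e.symm (X 1) + (i.val : Γ(X', O.1)) * e.symm (X 0))) ^ (2 * d)) ∈
      (traceFiltration 𝒜 (e.symm ∘ ![X 0, X 1]) ![2, 1]).ideal (d * (2 * p)) := by
  haveI : NeZero p := ⟨hp.ne_zero⟩
  rw [mem_traceFiltration_iff, he']
  exact A1.a1_cover_one_mem e d

omit [Finite G] [CharP k p] in
include he' in
/-- The plain cover element `y₀ = e′(x₀^{dp})` lies in the trace `K_{2dp}`. -/
theorem a1_hy_zero : e' (e.symm (X 0) ^ (d * p)) ∈ (traceFiltration 𝒜 (e.symm ∘ ![X 0, X 1]) ![2, 1]).ideal (d * (2 * p)) := by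
  rw [mem_traceFiltration_iff, he']
  exact A1.a1_cover_zero_mem e d

set_option maxHeartbeats 3000000 in
set_option synthInstance.maxHeartbeats 200000 in
include hp hG hC h0 h1 h2 h3 hact h𝒜 he' htame hσp hσ hver hG𝒦 h𝒦tr hsuppO in
/-- ★★★ **MOVE 1 OF MT-a1″ ON A REALISATION: the explicit atlas and its formal-locus bound.** For every realisation `π₁ : M₁ → X′` of the (2,1)-centre
(data of `a1_rootChartData`) and ANY root decoration `𝔄₀`: the NORM CHART `W = M₁[O, e′⁻¹(N^{2d})]` is a stable affine open, and there are two SECTIONS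
`z₀, z₁ ∈ Γ(M₁, W)` — the residual sections, pinned E-free by `z₀ · π^*(N^{2d}) = π^*(x₀^{dp})` and `z₁ · π^*(N^{2d}) = π^*((x₁x₂)^{2dp})` — and an atlas `𝔄₁` on
`M₁` whose carried formal locus lies in `π⁻¹(F_𝔄₀ ∖ O) ∪ (W ∩ V(z₀, z₁))` (the `[x₀]₂` chart is KILLED; for `O = X′` the first term is empty).
[OURS · L1 W4.5c · R-F15c move 1; NOT a statement of the manuscript] -/
theorem a1_move1_atlas (hd : 0 < d) (M₁ : GModel p q G ρ g₀) (π₁ : M₁.V ⟶ X') (hbl : IsBlowup π₁ (𝒦.ideal d)) (hr : M₁.r = π₁ ≫ (GModel.initial hq h₀).r)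
    (hcomm : ∀ g : G, (M₁.act.aut g).hom ≫ π₁ = π₁ ≫ ((GModel.initial hq h₀).act.aut g).hom)
    (𝔄₀ : NodeAtlasData p (GModel.initial hq h₀).act g₀) :
    ∃ (W : M₁.act.StableAffineOpens) (_ : IsAffineOpen W.1) (hWle : W.1 ≤ π₁ ⁻¹ᵁ O.1) (z₀ z₁ : Γ(M₁.V, W.1)) (𝔄₁ : NodeAtlasData p M₁.act g₀),
      (haveI : NeZero p := ⟨hp.ne_zero⟩;
        W.1 = blowupChart π₁ ((𝒦.ideal d) ^ (2 * p)) ⟨O.1, hO⟩ ((∏ i : ZMod p, (e.symm (X 1) + (i.val : Γ(X', O.1)) * e.symm (X 0))) ^ (2 * d)) ∧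
        z₀ * π₁.appLE O.1 W.1 hWle ((∏ i : ZMod p, (e.symm (X 1) + (i.val : Γ(X', O.1)) * e.symm (X 0))) ^ (2 * d)) =
          π₁.appLE O.1 W.1 hWle (e.symm (X 0) ^ (d * p)) ∧
        z₁ * π₁.appLE O.1 W.1 hWle ((∏ i : ZMod p, (e.symm (X 1) + (i.val : Γ(X', O.1)) * e.symm (X 0))) ^ (2 * d)) =
          π₁.appLE O.1 W.1 hWle ((e.symm (X 1) * e.symm (X 2)) ^ (d * (2 * p)))) ∧
      𝔄₁.fLocus ⊆ π₁.base ⁻¹' (𝔄₀.fLocus \ (O.1 : Set (GModel.initial (p := p) (g₀ := g₀) hq h₀).V)) ∪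
        (W.1 : Set M₁.V) ∩ {v | v ∉ M₁.V.basicOpen z₀ ∧ v ∉ M₁.V.basicOpen z₁} := by
  haveI : NeZero p := ⟨hp.ne_zero⟩
  haveI hchar : CharP Γ(X', O.1) p := charP_of_injective_ringHom (f := (e.symm : MvPolynomial (Fin 4) k →+* Γ(X', O.1))) e.symm.injective p
  have hp1 : p ≠ 1 := hp.one_lt.ne'
  have hdp : 0 < d * p := Nat.mul_pos hd hp.pos
  have hf := a1_hf hq h₀ O e 𝒜 h𝒜
  have hσJ := A1.a1_map_le σ hC h0 h1 h2 h3 e _ hact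
  have hw : ∀ i, 0 < (![2, 1] : Fin 2 → ℕ) i := fun i => by fin_cases i <;> norm_num
  have hK1 := A1.a1_isRegular e
  have hK1' := A1.a1_isRegularRing_quotient e
  have hk0 : 2 * p ≠ 0 := Nat.mul_ne_zero two_ne_zero hp.ne_zero
  have hverbar : VeroneseNormalised 𝒜 (e.symm ∘ ![X 0, X 1]) ![2, 1] (d * (2 * p)) :=
    CoarseChart.veroneseNormalised_mul 𝒜 _ _ hver (Nat.pos_of_ne_zero hk0)
  have hπ' : IsBlowup π₁ ((𝒦.ideal d) ^ (2 * p)) := isBlowup_pow hbl hk0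
  have hJ' : ((𝒦.ideal d) ^ (2 * p)).ideal ⟨O.1, hO⟩ =
      ((traceFiltration 𝒜 (e.symm ∘ ![X 0, X 1]) ![2, 1]).ideal (d * (2 * p))).comap (e' : Γ(X', O.1) →+* ↥(𝒜 0)) := by
    rw [Scheme.IdealSheafData.ideal_pow, Pi.pow_apply, ← ReesFiltration.filtration_ideal, h𝒦tr d, hver.2 (2 * p), comap_equiv_pow]
  -- the cover, kept opaque
  obtain ⟨a₀, ha₀⟩ : ∃ a : Γ(X', O.1), a = e.symm (X 0) ^ (d * p) := ⟨_, rfl⟩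
  obtain ⟨a₁, ha₁⟩ : ∃ a : Γ(X', O.1), a = (∏ i : ZMod p, (e.symm (X 1) + (i.val : Γ(X', O.1)) * e.symm (X 0))) ^ (2 * d) := ⟨_, rfl⟩
  obtain ⟨y, hy0, hy1⟩ : ∃ y : Fin 2 → ↥(𝒜 0), y 0 = e' a₀ ∧ y 1 = e' a₁ := ⟨![e' a₀, e' a₁], rfl, rfl⟩
  have hyval : ∀ j, (y j).1 = (![a₀, a₁] : Fin 2 → Γ(X', O.1)) j := fun j => by
    fin_cases j
    · change (y 0).1 = a₀; rw [hy0]; exact he' a₀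
    · change (y 1).1 = a₁; rw [hy1]; exact he' a₁
  have hy : ∀ j, y j ∈ (traceFiltration 𝒜 (e.symm ∘ ![X 0, X 1]) ![2, 1]).ideal (d * (2 * p)) := fun j => by
    rw [mem_traceFiltration_iff, hyval]
    fin_cases j
    · change a₀ ∈ _; rw [ha₀]; exact A1.a1_cover_zero_mem e d
    · change a₁ ∈ _; rw [ha₁]; exact A1.a1_cover_one_mem e d
  have hσy : ∀ j, actOEquiv (GModel.initial hq h₀).act O g₀ (y j).1 = (y j).1 := fun j => by
    rw [hyval]
    fin_cases j
    · change actOEquiv (GModel.initial hq h₀).act O g₀ a₀ = a₀; rw [ha₀]; exact A1.a1_cover_zero_fixed σ h0 e _ hact d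
    · change actOEquiv (GModel.initial hq h₀).act O g₀ a₁ = a₁; rw [ha₁]; exact A1.a1_cover_one_fixed σ h0 h1 e _ hact hp1 d
  have hrad : ∀ i : Fin 2, cobordantAlgebra.u' (e.symm ∘ ![X 0, X 1]) ![2, 1] i ∈
      (Ideal.span (Set.range fun j => coverElement 𝒜 (e.symm ∘ ![X 0, X 1]) ![2, 1] (d * (2 * p)) (y j) (hy j))).radical := by
    intro i
    have h := A1.a1_hrad e (p := p) d (coverElement 𝒜 (e.symm ∘ ![X 0, X 1]) ![2, 1] (d * (2 * p)) (y 0) (hy 0))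
      (coverElement 𝒜 (e.symm ∘ ![X 0, X 1]) ![2, 1] (d * (2 * p)) (y 1) (hy 1)) (by rw [coe_coverElement, hyval, ← ha₀]; rfl)
      (by rw [coe_coverElement, hyval, ← ha₁]; rfl) i
    refine Ideal.radical_mono (Ideal.span_mono ?_) h
    exact Set.insert_subset_iff.mpr ⟨⟨0, rfl⟩, Set.singleton_subset_iff.mpr ⟨1, rfl⟩⟩
  -- the producer charts
  have hxJ : ∀ j, e'.symm (y j) ∈ ((𝒦.ideal d) ^ (2 * p)).ideal ⟨O.1, hO⟩ := fun j => by
    rw [hJ', Ideal.mem_comap, RingHom.coe_coe, e'.apply_symm_apply]; exact hy j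
  have hfix : ∀ (j) (g : G), ((GModel.initial hq h₀).act.aut g).hom.appLE O.1 O.1 (O.2.1 g).ge (e'.symm (y j)) = e'.symm (y j) := fun j g => by
    have hfix₀ : ((GModel.initial hq h₀).act.aut g₀⁻¹).hom.appLE O.1 O.1 (O.2.1 g₀⁻¹).ge (e'.symm (y j)) = e'.symm (y j) := by
      apply e'.injective
      apply Subtype.ext
      rw [hσ (e'.symm (y j)), e'.apply_symm_apply]
      exact hσy j
    exact appLE_aut_eq_self_of_mem_zpowers (GModel.initial hq h₀).act O.1 O.2.1 hfix₀ (by rw [Subgroup.zpowers_inv]; exact hG g)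
  have hρk : ∀ g : G, ((𝒦.ideal d) ^ (2 * p)).comap ((GModel.initial hq h₀).act.aut g).hom = (𝒦.ideal d) ^ (2 * p) := fun g => by
    rw [comap_pow]; exact congrArg (· ^ (2 * p)) (hG𝒦 g d)
  have hW : ∀ j, ∃ O' : M₁.act.StableAffineOpens, O'.1 = blowupChart π₁ ((𝒦.ideal d) ^ (2 * p)) ⟨O.1, hO⟩ (e'.symm (y j)) ∧ IsAffineOpen O'.1 := fun j =>
    exists_stable_blowupChart (GModel.initial hq h₀).act hπ' M₁.act hr hcomm hρk O hO (e'.symm (y j)) (hxJ j) (hfix j)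
  choose OW hOWeq hOWaff using hW
  have hWle : ∀ j, (OW j).1 ≤ π₁ ⁻¹ᵁ O.1 := fun j => by rw [hOWeq j]; exact blowupChart_le_preimage π₁ _ ⟨O.1, hO⟩ _
  have hnode := fun j => exists_nodeData_blowupChart_pin (GModel.initial hq h₀).act M₁.act hcomm g₀ ![] 𝒜 (e.symm ∘ ![X 0, X 1]) ![2, 1] hf hp.pos O hO
    (actOEquiv (GModel.initial hq h₀).act O g₀) e' htame hσp hσ hw hK1 hK1' hσJ hπ' hverbar hJ' (y j) (hy j) (hσy j) (OW j) (hOWeq j)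
  choose E htame' hE hpin using hnode
  -- (H1) and the residual sections on each chart
  have hH1 := A1.a1_augmentationIdeal_sigmaR_le σ hC h0 h1 h2 h3 e _ hact hp.pos hσp
  have hmem0 := A1.a1_u'_zero_mem_residual σ hC h0 h1 h2 h3 e _ hact hp.pos hσp
  have hmem1 := A1.a1_u'_one_mul_mem_residual σ hC h0 h1 h2 h3 e _ hact hp.pos hσp
  have hx2 : e.symm (X 2) ∈ 𝒜 0 := by rw [h𝒜]; trivial
  have hz0 := fun j => A1.a1_residualSection_zero e ![] 𝒜 hf (y j) (hy j) d rfl _ hmem0 hdp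
  have hz1 := fun j => A1.a1_residualSection_one e ![] 𝒜 hf hx2 (y j) (hy j) d rfl _ hmem1 hd hp.pos
  -- the literal nodes and their residual sets
  obtain ⟨DW, hDWdef⟩ : ∃ DW : ∀ j, NodeData p M₁.act g₀ (OW j), DW = fun j =>
      letI := chartNodeGradedRing ![] 𝒜 (e.symm ∘ ![X 0, X 1]) ![2, 1] hf (d * (2 * p)) (y j) (hy j)
      { affine := hOWaff j, m := 0 + 1, r := Fin.cons 0 ![], B := ChartRing 𝒜 (e.symm ∘ ![X 0, X 1]) ![2, 1] (d * (2 * p)) (y j) (hy j),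
        𝒜 := chartNodeGrading ![] 𝒜 (e.symm ∘ ![X 0, X 1]) ![2, 1] hf (d * (2 * p)) (y j) (hy j),
        σ := sigmaChart 𝒜 (e.symm ∘ ![X 0, X 1]) ![2, 1] (d * (2 * p)) (y j) (hy j) (actOEquiv (GModel.initial hq h₀).act O g₀) hσJ hp.pos hσp (hσy j),
        e := E j, tame := htame' j, intertwine := hE j } := ⟨_, rfl⟩
  obtain ⟨z0s, hz0sdef⟩ : ∃ z : ∀ j, Γ(M₁.V, (OW j).1), ∀ j, z j =
      (letI := chartNodeGradedRing ![] 𝒜 (e.symm ∘ ![X 0, X 1]) ![2, 1] hf (d * (2 * p)) (y j) (hy j); (E j).symm ⟨_, (hz0 j).1⟩) := ⟨_, fun _ => rfl⟩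
  obtain ⟨z1s, hz1sdef⟩ : ∃ z : ∀ j, Γ(M₁.V, (OW j).1), ∀ j, z j =
      (letI := chartNodeGradedRing ![] 𝒜 (e.symm ∘ ![X 0, X 1]) ![2, 1] hf (d * (2 * p)) (y j) (hy j); (E j).symm ⟨_, (hz1 j).1⟩) := ⟨_, fun _ => rfl⟩
  let R : Fin 2 → Set M₁.V := fun j => {v | v ∉ M₁.V.basicOpen (z0s j) ∧ v ∉ M₁.V.basicOpen (z1s j)}
  have hDW : ∀ j, ∀ v ∈ (OW j).1, v ∉ R j → (DW j).PrincipalNear v := by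
    intro j v _ hRv
    rw [hDWdef]
    simp only [R, Set.mem_setOf_eq, not_and_or, not_not] at hRv
    rcases hRv with hv0 | hv1
    · rw [hz0sdef] at hv0
      exact principalNear_producerChart_of_mem_residual hG (OW j) (hOWaff j) (E j) (htame' j) (hE j) hH1 ⟨_, (hz0 j).1⟩ (hz0 j).2 hv0
    · rw [hz1sdef] at hv1
      exact principalNear_producerChart_of_mem_residual hG (OW j) (hOWaff j) (E j) (htame' j) (hE j) hH1 ⟨_, (hz1 j).1⟩ (hz1 j).2 hv1
  -- the charts cover `π⁻¹ O`
  have hcovW := iSup_blowupChart_eq_preimage (I := 𝒦.ideal d) (GModel.initial hq h₀).act ![] 𝒜 (e.symm ∘ ![X 0, X 1]) ![2, 1] hf O hO e' hπ' hverbar hJ' y hy hrad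
  have hcov : ∀ v' : M₁.V, π₁.base v' ∈ (O.1 : Set (GModel.initial (p := p) (g₀ := g₀) hq h₀).V) → ∃ j, v' ∈ (OW j).1 := fun v' hv => by
    have hv'W : v' ∈ ⨆ j, blowupChart π₁ ((𝒦.ideal d) ^ (2 * p)) ⟨O.1, hO⟩ (e'.symm (y j)) := by rw [hcovW]; exact hv
    obtain ⟨j, hj⟩ := Opens.mem_iSup.mp hv'W
    exact ⟨j, by rw [hOWeq j]; exact hj⟩
  obtain ⟨𝔄₁, hF⟩ := exists_moveAtlas_of_nodeData (GModel.initial hq h₀) M₁ 𝔄₀ 𝒦 d (fun g => hG𝒦 g d) π₁ hbl hr hcomm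
    (O.1 : Set (GModel.initial (p := p) (g₀ := g₀) hq h₀).V) hsuppO OW DW hcov R hDW
  -- chart 0 is killed: its first residual section is `1`
  have hunit0 : algebraMap _ (ChartRing 𝒜 (e.symm ∘ ![X 0, X 1]) ![2, 1] (d * (2 * p)) (y 0) (hy 0))
        (cobordantAlgebra.u' (e.symm ∘ ![X 0, X 1]) ![2, 1] 0 ^ (d * p)) *
      IsLocalization.Away.invSelf (coverElement 𝒜 (e.symm ∘ ![X 0, X 1]) ![2, 1] (d * (2 * p)) (y 0) (hy 0)) = 1 := by
    have hc : coverElement 𝒜 (e.symm ∘ ![X 0, X 1]) ![2, 1] (d * (2 * p)) (y 0) (hy 0) = cobordantAlgebra.u' (e.symm ∘ ![X 0, X 1]) ![2, 1] 0 ^ (d * p) := by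
      refine Subtype.ext ?_
      rw [coe_coverElement, SubmonoidClass.coe_pow, cobordantAlgebra.coe_u', hyval]
      change LaurentPolynomial.C a₀ * _ = (LaurentPolynomial.C (e.symm (X 0)) * LaurentPolynomial.T ((2 : ℕ) : ℤ)) ^ (d * p)
      rw [ha₀, mul_pow, map_pow, LaurentPolynomial.T_pow]
      congr 2
      push_cast
      ring
    rw [← hc]
    exact IsLocalization.Away.mul_invSelf _
  have hz0W : ∀ v ∈ (OW 0).1, v ∈ M₁.V.basicOpen (z0s 0) := fun v hv => by
    letI := chartNodeGradedRing ![] 𝒜 (e.symm ∘ ![X 0, X 1]) ![2, 1] hf (d * (2 * p)) (y 0) (hy 0)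
    have h1 : (⟨_, (hz0 0).1⟩ : ↥(chartNodeGrading ![] 𝒜 (e.symm ∘ ![X 0, X 1]) ![2, 1] hf (d * (2 * p)) (y 0) (hy 0) 0)) = 1 := Subtype.ext hunit0
    have h2 : z0s 0 = 1 := (hz0sdef 0).trans (((E 0).symm.congr_arg h1).trans (map_one (E 0).symm))
    rw [h2, Scheme.basicOpen_of_isUnit _ isUnit_one]
    exact hv
  -- the pins of the residual sections of chart 1 (E-free)
  have hzpin : ∀ (v : ↥(cobordantAlgebra (e.symm ∘ ![X 0, X 1]) ![2, 1])) (a : Γ(X', O.1)) (hv : (v : Γ(X', O.1)[T;T⁻¹]) =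
      LaurentPolynomial.C a * LaurentPolynomial.T ((d * (2 * p) : ℕ) : ℤ))
      (hvm : letI := chartNodeGradedRing ![] 𝒜 (e.symm ∘ ![X 0, X 1]) ![2, 1] hf (d * (2 * p)) (y 1) (hy 1);
        algebraMap _ (ChartRing 𝒜 (e.symm ∘ ![X 0, X 1]) ![2, 1] (d * (2 * p)) (y 1) (hy 1)) v *
          IsLocalization.Away.invSelf (coverElement 𝒜 (e.symm ∘ ![X 0, X 1]) ![2, 1] (d * (2 * p)) (y 1) (hy 1)) ∈
          chartNodeGrading ![] 𝒜 (e.symm ∘ ![X 0, X 1]) ![2, 1] hf (d * (2 * p)) (y 1) (hy 1) 0),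
      (letI := chartNodeGradedRing ![] 𝒜 (e.symm ∘ ![X 0, X 1]) ![2, 1] hf (d * (2 * p)) (y 1) (hy 1); (E 1).symm ⟨_, hvm⟩) *
        π₁.appLE O.1 (OW 1).1 (hWle 1) a₁ = π₁.appLE O.1 (OW 1).1 (hWle 1) a := by
    intro v a hv hvm
    letI := chartNodeGradedRing ![] 𝒜 (e.symm ∘ ![X 0, X 1]) ![2, 1] hf (d * (2 * p)) (y 1) (hy 1)
    have q1 := hpin 1 (hWle 1) a₁
    have q2 := hpin 1 (hWle 1) a
    apply (E 1).injective
    have hE1 : (E 1) ((E 1).symm ⟨_, hvm⟩ * π₁.appLE O.1 (OW 1).1 (hWle 1) a₁) = ⟨_, hvm⟩ * (E 1) (π₁.appLE O.1 (OW 1).1 (hWle 1) a₁) :=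
      (map_mul (E 1) ((E 1).symm ⟨_, hvm⟩) (π₁.appLE O.1 (OW 1).1 (hWle 1) a₁)).trans
        (congrArg (· * (E 1) (π₁.appLE O.1 (OW 1).1 (hWle 1) a₁)) ((E 1).apply_symm_apply ⟨_, hvm⟩))
    refine hE1.trans ?_
    apply Subtype.ext
    refine (SetLike.GradeZero.coe_mul _ _).trans ?_
    refine (congrArg (fun r => _ * r) q1).trans ?_
    refine Eq.trans ?_ q2.symm
    change (algebraMap _ (ChartRing 𝒜 (e.symm ∘ ![X 0, X 1]) ![2, 1] (d * (2 * p)) (y 1) (hy 1)) v *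
        IsLocalization.Away.invSelf (coverElement 𝒜 (e.symm ∘ ![X 0, X 1]) ![2, 1] (d * (2 * p)) (y 1) (hy 1))) *
      toChartRing 𝒜 (e.symm ∘ ![X 0, X 1]) ![2, 1] (d * (2 * p)) (y 1) (hy 1) (e' a₁) = toChartRing 𝒜 (e.symm ∘ ![X 0, X 1]) ![2, 1] (d * (2 * p)) (y 1) (hy 1) (e' a)
    -- `v · h⁻¹ · (C a₁) = C a` because `h = C a₁ · T^{dbar}` and `v = C a · T^{dbar}`
    have hRw : v * algebraMap (Γ(X', O.1)) ↥(cobordantAlgebra (e.symm ∘ ![X 0, X 1] : Fin 2 → Γ(X', O.1)) ![2, 1]) a₁ =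
        algebraMap (Γ(X', O.1)) ↥(cobordantAlgebra (e.symm ∘ ![X 0, X 1] : Fin 2 → Γ(X', O.1)) ![2, 1]) a * coverElement 𝒜 (e.symm ∘ ![X 0, X 1]) ![2, 1] (d * (2 * p)) (y 1) (hy 1) := by
      refine Subtype.ext ?_
      rw [MulMemClass.coe_mul, MulMemClass.coe_mul, cobordantAlgebra.coe_algebraMap, cobordantAlgebra.coe_algebraMap, hv, coe_coverElement, hyval]
      change LaurentPolynomial.C a * LaurentPolynomial.T _ * LaurentPolynomial.C a₁ = LaurentPolynomial.C a * (LaurentPolynomial.C a₁ * LaurentPolynomial.T _)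
      ring
    have e1 : toChartRing 𝒜 (e.symm ∘ ![X 0, X 1]) ![2, 1] (d * (2 * p)) (y 1) (hy 1) (e' a₁) =
        algebraMap _ (ChartRing 𝒜 (e.symm ∘ ![X 0, X 1]) ![2, 1] (d * (2 * p)) (y 1) (hy 1)) (algebraMap (Γ(X', O.1)) ↥(cobordantAlgebra (e.symm ∘ ![X 0, X 1] : Fin 2 → Γ(X', O.1)) ![2, 1]) a₁) := by
      change algebraMap _ _ (algebraMap (Γ(X', O.1)) ↥(cobordantAlgebra (e.symm ∘ ![X 0, X 1] : Fin 2 → Γ(X', O.1)) ![2, 1]) (((e' a₁ : ↥(𝒜 0)) : Γ(X', O.1)))) = _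
      rw [he']
    have e2 : toChartRing 𝒜 (e.symm ∘ ![X 0, X 1]) ![2, 1] (d * (2 * p)) (y 1) (hy 1) (e' a) =
        algebraMap _ (ChartRing 𝒜 (e.symm ∘ ![X 0, X 1]) ![2, 1] (d * (2 * p)) (y 1) (hy 1)) (algebraMap (Γ(X', O.1)) ↥(cobordantAlgebra (e.symm ∘ ![X 0, X 1] : Fin 2 → Γ(X', O.1)) ![2, 1]) a) := by
      change algebraMap _ _ (algebraMap (Γ(X', O.1)) ↥(cobordantAlgebra (e.symm ∘ ![X 0, X 1] : Fin 2 → Γ(X', O.1)) ![2, 1]) (((e' a : ↥(𝒜 0)) : Γ(X', O.1)))) = _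
      rw [he']
    rw [e1, e2]
    have key : algebraMap (↥(cobordantAlgebra (e.symm ∘ ![X 0, X 1] : Fin 2 → Γ(X', O.1)) ![2, 1])) (ChartRing 𝒜 (e.symm ∘ ![X 0, X 1]) ![2, 1] (d * (2 * p)) (y 1) (hy 1)) v * algebraMap (↥(cobordantAlgebra (e.symm ∘ ![X 0, X 1] : Fin 2 → Γ(X', O.1)) ![2, 1])) (ChartRing 𝒜 (e.symm ∘ ![X 0, X 1]) ![2, 1] (d * (2 * p)) (y 1) (hy 1)) (algebraMap (Γ(X', O.1)) (↥(cobordantAlgebra (e.symm ∘ ![X 0, X 1] : Fin 2 → Γ(X', O.1)) ![2, 1])) a₁) =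
        algebraMap (↥(cobordantAlgebra (e.symm ∘ ![X 0, X 1] : Fin 2 → Γ(X', O.1)) ![2, 1])) (ChartRing 𝒜 (e.symm ∘ ![X 0, X 1]) ![2, 1] (d * (2 * p)) (y 1) (hy 1)) (algebraMap (Γ(X', O.1)) (↥(cobordantAlgebra (e.symm ∘ ![X 0, X 1] : Fin 2 → Γ(X', O.1)) ![2, 1])) a) * algebraMap (↥(cobordantAlgebra (e.symm ∘ ![X 0, X 1] : Fin 2 → Γ(X', O.1)) ![2, 1])) (ChartRing 𝒜 (e.symm ∘ ![X 0, X 1]) ![2, 1] (d * (2 * p)) (y 1) (hy 1)) (coverElement 𝒜 (e.symm ∘ ![X 0, X 1]) ![2, 1] (d * (2 * p)) (y 1) (hy 1)) := by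
      rw [← map_mul, hRw, map_mul]
    calc algebraMap (↥(cobordantAlgebra (e.symm ∘ ![X 0, X 1] : Fin 2 → Γ(X', O.1)) ![2, 1])) (ChartRing 𝒜 (e.symm ∘ ![X 0, X 1]) ![2, 1] (d * (2 * p)) (y 1) (hy 1)) v * IsLocalization.Away.invSelf (coverElement 𝒜 (e.symm ∘ ![X 0, X 1]) ![2, 1] (d * (2 * p)) (y 1) (hy 1)) * algebraMap (↥(cobordantAlgebra (e.symm ∘ ![X 0, X 1] : Fin 2 → Γ(X', O.1)) ![2, 1])) (ChartRing 𝒜 (e.symm ∘ ![X 0, X 1]) ![2, 1] (d * (2 * p)) (y 1) (hy 1)) (algebraMap (Γ(X', O.1)) (↥(cobordantAlgebra (e.symm ∘ ![X 0, X 1] : Fin 2 → Γ(X', O.1)) ![2, 1])) a₁)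
        = algebraMap (↥(cobordantAlgebra (e.symm ∘ ![X 0, X 1] : Fin 2 → Γ(X', O.1)) ![2, 1])) (ChartRing 𝒜 (e.symm ∘ ![X 0, X 1]) ![2, 1] (d * (2 * p)) (y 1) (hy 1)) v * algebraMap (↥(cobordantAlgebra (e.symm ∘ ![X 0, X 1] : Fin 2 → Γ(X', O.1)) ![2, 1])) (ChartRing 𝒜 (e.symm ∘ ![X 0, X 1]) ![2, 1] (d * (2 * p)) (y 1) (hy 1)) (algebraMap (Γ(X', O.1)) (↥(cobordantAlgebra (e.symm ∘ ![X 0, X 1] : Fin 2 → Γ(X', O.1)) ![2, 1])) a₁) * IsLocalization.Away.invSelf (coverElement 𝒜 (e.symm ∘ ![X 0, X 1]) ![2, 1] (d * (2 * p)) (y 1) (hy 1)) := by ring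
      _ = algebraMap (↥(cobordantAlgebra (e.symm ∘ ![X 0, X 1] : Fin 2 → Γ(X', O.1)) ![2, 1])) (ChartRing 𝒜 (e.symm ∘ ![X 0, X 1]) ![2, 1] (d * (2 * p)) (y 1) (hy 1)) (algebraMap (Γ(X', O.1)) (↥(cobordantAlgebra (e.symm ∘ ![X 0, X 1] : Fin 2 → Γ(X', O.1)) ![2, 1])) a) * algebraMap (↥(cobordantAlgebra (e.symm ∘ ![X 0, X 1] : Fin 2 → Γ(X', O.1)) ![2, 1])) (ChartRing 𝒜 (e.symm ∘ ![X 0, X 1]) ![2, 1] (d * (2 * p)) (y 1) (hy 1)) (coverElement 𝒜 (e.symm ∘ ![X 0, X 1]) ![2, 1] (d * (2 * p)) (y 1) (hy 1)) * IsLocalization.Away.invSelf (coverElement 𝒜 (e.symm ∘ ![X 0, X 1]) ![2, 1] (d * (2 * p)) (y 1) (hy 1)) := by rw [key]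
      _ = algebraMap (↥(cobordantAlgebra (e.symm ∘ ![X 0, X 1] : Fin 2 → Γ(X', O.1)) ![2, 1])) (ChartRing 𝒜 (e.symm ∘ ![X 0, X 1]) ![2, 1] (d * (2 * p)) (y 1) (hy 1)) (algebraMap (Γ(X', O.1)) (↥(cobordantAlgebra (e.symm ∘ ![X 0, X 1] : Fin 2 → Γ(X', O.1)) ![2, 1])) a) := by
        rw [mul_assoc, IsLocalization.Away.mul_invSelf, mul_one]
  -- assemble
  refine ⟨OW 1, hOWaff 1, hWle 1, z0s 1, z1s 1, 𝔄₁, ⟨?_, ?_, ?_⟩, fun v hv => ?_⟩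
  · rw [hOWeq 1]
    congr 1
    apply e'.injective
    apply Subtype.ext
    rw [e'.apply_symm_apply, hyval, he']
    exact ha₁
  · have hvcoe : ((cobordantAlgebra.u' (e.symm ∘ ![X 0, X 1] : Fin 2 → Γ(X', O.1)) ![2, 1] 0 ^ (d * p) :
        ↥(cobordantAlgebra (e.symm ∘ ![X 0, X 1] : Fin 2 → Γ(X', O.1)) ![2, 1])) : Γ(X', O.1)[T;T⁻¹]) =
        LaurentPolynomial.C a₀ * LaurentPolynomial.T ((d * (2 * p) : ℕ) : ℤ) := by
      rw [SubmonoidClass.coe_pow, cobordantAlgebra.coe_u', ha₀]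
      change (LaurentPolynomial.C (e.symm (X 0)) * LaurentPolynomial.T ((2 : ℕ) : ℤ)) ^ (d * p) = _
      rw [mul_pow, ← map_pow, LaurentPolynomial.T_pow]
      congr 2
      push_cast
      ring
    have h := hzpin _ a₀ hvcoe (hz0 1).1
    rw [ha₁, ha₀] at h
    rw [hz0sdef 1]
    exact h
  · have hvcoe : (((cobordantAlgebra.u' (e.symm ∘ ![X 0, X 1] : Fin 2 → Γ(X', O.1)) ![2, 1] 1 *
        algebraMap (Γ(X', O.1)) (↥(cobordantAlgebra (e.symm ∘ ![X 0, X 1] : Fin 2 → Γ(X', O.1)) ![2, 1])) (e.symm (X 2))) ^ (d * (2 * p)) :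
        ↥(cobordantAlgebra (e.symm ∘ ![X 0, X 1] : Fin 2 → Γ(X', O.1)) ![2, 1])) : Γ(X', O.1)[T;T⁻¹]) =
        LaurentPolynomial.C ((e.symm (X 1) * e.symm (X 2)) ^ (d * (2 * p))) * LaurentPolynomial.T ((d * (2 * p) : ℕ) : ℤ) := by
      rw [SubmonoidClass.coe_pow, MulMemClass.coe_mul, cobordantAlgebra.coe_u', cobordantAlgebra.coe_algebraMap]
      change (LaurentPolynomial.C (e.symm (X 1)) * LaurentPolynomial.T ((1 : ℕ) : ℤ) * LaurentPolynomial.C (e.symm (X 2))) ^ (d * (2 * p)) = _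
      rw [map_pow, mul_right_comm, mul_pow, ← map_mul, LaurentPolynomial.T_pow]
      congr 2
      push_cast
      ring
    have h := hzpin _ ((e.symm (X 1) * e.symm (X 2)) ^ (d * (2 * p))) hvcoe (hz1 1).1
    rw [ha₁] at h
    rw [hz1sdef 1]
    exact h
  · rcases hF hv with hold | hnew
    · exact Or.inl hold
    · obtain ⟨j, hvW, hvR⟩ := Set.mem_iUnion.mp hnew
      revert hvW hvR
      refine Fin.cases ?_ (fun j' => Fin.cases ?_ (fun j'' => j''.elim0) j') j
      · intro hvW hvR
        exact absurd (hz0W v hvW) hvR.1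
      · intro hvW hvR
        exact Or.inr ⟨hvW, hvR⟩

end Atlas

end Summit.ResolutionOfSingularities.ResolutionOfSingularities.Theorems.WildQuotientResolution.S1.GameFrame.GModel

end
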